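import Literature.NumberTheory.Automorphic.CMPrincipalSeriesTraceOrbitalFormTwo          -- (δ₂) van Dijk against canonical orbital integrals on `U(Φ₂)(L⁺_v)` (rank one)
import Summits.HodgeConjecture.HodgeConjecture.Theorems.K2E3QuasiSplitTwoTorusDefs        -- ★ p860691 D115 (TOR₂-Defs): `vanDijkWeight₂` (K2E3-p26 (g0))
import Literature.NumberTheory.Automorphic.CMTorusRegularAEPairwise                       -- ★ `ae_isUnit_torusEntry_sub_two`
import Literature.NumberTheory.Automorphic.UnitaryGroupFormCongrFinSum                    -- ★ `formCongr_one_eq`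
import HarnessLib

/-!
# K2 · E3 · road (qs2-ps) «van Dijk₂», brick (VDW₂) (dealer K2E3-plan (g4) D116): van Dijk's formula on `U(Φ₂)(L⁺_v) = U(1,1)` against
# CANONICAL orbital integrals, with the weight `Δ₂ = vanDijkWeight₂` of ★ D115
# `Tr i_G(χ)(φ) = μ_T(T₂ ∩ K_v)⁻¹ · ∫_{T₂} χ(t) · Δ₂(t) · O^{can}_t(φ) dμ_T`  [Rogawski1990, §4.9 (4.9.4) p. 56; §12.7 L. 12.7.2 (proof) p. 193]

Cell `pub/hodgecm-mathlib`, crux H413 = `stmt-HodgeConjecture-24833` (`--supports` lane), route HCCMUnconditional; seat K2E3-p11 (g7).  The `N = 2`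
twin of ★ `F0P3cStCharTSPsmTransport.smoothTrace_eq_inv_mul_integral_vanDijkWeight` (my lineage, K2E3-p11 g3 ∕ LH6): the identity frame of
`U(Φ₂)(L⁺_v)` fed to the (δ₂) orbital form ★ `smoothTrace_cmPrincipalSeries_two_map_symm_eq_inv_mul_integral` with
`Φ := χ · vanDijkWeight₂ · O^{can}` (the `dite` of ★ `vanDijkWeight₂` is `μ_T`-a.e. in its regular branch, ★ `ae_isUnit_torusEntry_sub_two`).
THEOREMS ONLY, sorry-free.  HONEST LABEL: HC_CM is proved only modulo the 7 printed citations (2 remaining named inputs: hLiu418 =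
stmt-HodgeConjecture-24832, h413 = stmt-HodgeConjecture-24833) until rung 0 closes; count-neutral helper ((VDW₂) feeds (ASM₂) of the (qs2-ps) socket).

## Mathlib ∕ tree search
(δ₂) `smoothTrace_cmPrincipalSeries_two_map_symm_eq_inv_mul_integral` (this road) · ★ `vanDijkWeight₂` (D115) · ★ `ae_isUnit_torusEntry_sub_two` ·
★ `formCongr_one_eq` · ★ `cmDatumLocalCongr` ∕ `coe_cmDatumLocalCongr_apply` · ★ `antidiagOne_isHermitian` ∕ `isUnit_antidiagOne_det` · ★ `torusEntry_eq_of_glDiagonal_eq`.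
Dedup: `rg "vanDijkWeight₂" Summits/…/Theorems` — only D115.

## References
* [Rogawski1990] J. D. Rogawski, *Automorphic Representations of Unitary Groups in Three Variables* (1990), §4.9 (4.9.4) p. 56; §12.7 L. 12.7.2 p. 193.
* [vanDijk1972] G. van Dijk, *Computation of certain induced characters of p-adic groups*, Math. Ann. 199 (1972), Thm. p. 237.
-/

set_option autoImplicit false
-- the mandated namespace has the single-problem summit's repeated segment (`HodgeConjecture.HodgeConjecture`)
set_option linter.dupNamespace false

noncomputable section

open NumberField IsDedekindDomain MeasureTheory MeasureTheory.Measure Filter Topology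
open scoped Matrix MatrixGroups NNReal
open Literature.NumberTheory.Rogawski1990 (IsRegularElt)
open Literature.NumberTheory.Automorphic Literature.NumberTheory.Automorphic.UnitaryGroup
open Literature.MeasureTheory.Group
open Summit.HodgeConjecture.HodgeConjecture.Cruxes.H413.K2E3QuasiSplitTwoTorusDefs

namespace Summit.HodgeConjecture.HodgeConjecture.Cruxes.H413.K2E3QuasiSplitTwoVanDijk

variable (L : Type) [Field L] [NumberField L] [IsCMField L] (v : HeightOneSpectrum (𝓞 ↥(maximalRealSubfield L)))

set_option maxHeartbeats 1600000 in
-- instance-term unification on the CM local carrier (as in the ★ `N = 3` original `F0P3cStCharTSPsmTransport.smoothTrace_eq_inv_mul_integral_vanDijkWeight`)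
/-- **(VDW₂) `Tr i_G(χ)(φ) = μ_T(T₂ ∩ K_v)⁻¹ · ∫_{T₂} χ(t) · Δ₂(t) · Φ^{can}(t, φ) dμ_T`** on `G₂ = U(Φ₂)(L⁺_v)` (`v` non-split in `L ∕ L⁺`), for every continuous
`χ : T₂ →* ℂˣ`, every Haar measure `ν` of `G₂` with CANONICAL orbital measures `m` (★ `IsCanonical` for `IsRegularElt`), every Haar `μ_T` on `T₂` and every
locally constant compactly supported `φ` — ★ (δ₂) at the identity frame with `Φ := χ · vanDijkWeight₂ · O^{can}` (the `dite` of ★ `vanDijkWeight₂` is `μ_T`-a.e.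
in its regular branch, ★ `ae_isUnit_torusEntry_sub_two`). [cite: Rogawski1990, §4.9 (4.9.4) p. 56; §12.7 L. 12.7.2 (proof) p. 193] [cite: vanDijk1972, Thm. p. 237] -/
theorem smoothTrace_eq_inv_mul_integral_vanDijkWeight₂
    (hns : ∀ w : PlacesOver L v, IsCMField.complexConj L • w.1 = w.1)
    [MeasurableSpace ((UnitaryGroup.cmDatum L 2 (Matrix.of fun i j : Fin 2 => if i.val + j.val + 1 = 2 then (1 : L) else 0)).Local v)] [BorelSpace ((UnitaryGroup.cmDatum L 2 (Matrix.of fun i j : Fin 2 => if i.val + j.val + 1 = 2 then (1 : L) else 0)).Local v)]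
    [∀ γ : (UnitaryGroup.cmDatum L 2 (Matrix.of fun i j : Fin 2 => if i.val + j.val + 1 = 2 then (1 : L) else 0)).Local v,
      MeasurableSpace (((UnitaryGroup.cmDatum L 2 (Matrix.of fun i j : Fin 2 => if i.val + j.val + 1 = 2 then (1 : L) else 0)).Local v) ⧸ Subgroup.centralizer ({γ} : Set ((UnitaryGroup.cmDatum L 2 (Matrix.of fun i j : Fin 2 => if i.val + j.val + 1 = 2 then (1 : L) else 0)).Local v)))]
    [∀ γ : (UnitaryGroup.cmDatum L 2 (Matrix.of fun i j : Fin 2 => if i.val + j.val + 1 = 2 then (1 : L) else 0)).Local v,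
      BorelSpace (((UnitaryGroup.cmDatum L 2 (Matrix.of fun i j : Fin 2 => if i.val + j.val + 1 = 2 then (1 : L) else 0)).Local v) ⧸ Subgroup.centralizer ({γ} : Set ((UnitaryGroup.cmDatum L 2 (Matrix.of fun i j : Fin 2 => if i.val + j.val + 1 = 2 then (1 : L) else 0)).Local v)))]
    (ν : Measure ((UnitaryGroup.cmDatum L 2 (Matrix.of fun i j : Fin 2 => if i.val + j.val + 1 = 2 then (1 : L) else 0)).Local v)) [ν.IsHaarMeasure] [ν.IsMulRightInvariant]
    (m : OrbitalMeasureFamily ((UnitaryGroup.cmDatum L 2 (Matrix.of fun i j : Fin 2 => if i.val + j.val + 1 = 2 then (1 : L) else 0)).Local v))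
    (hcan : m.IsCanonical (fun γ => IsRegularElt (γ.val : GL (Fin 2) (UnitaryGroup.LocalRing L v))) ν)
    (χ : ↥(cmBorelTriple L 2 v).M →* ℂˣ) (hχ : Continuous fun t => ((χ t : ℂˣ) : ℂ))
    (φ : (UnitaryGroup.cmDatum L 2 (Matrix.of fun i j : Fin 2 => if i.val + j.val + 1 = 2 then (1 : L) else 0)).Local v → ℂ) (hφ : IsLocallyConstant φ) (hφc : HasCompactSupport φ) :
    letI : MeasurableSpace ↥(unitaryGroupOfForm (conjLocal L (IsCMField.complexConj L) v) (cmLocalForm L 2 v)) := ‹MeasurableSpace ((UnitaryGroup.cmDatum L 2 (Matrix.of fun i j : Fin 2 => if i.val + j.val + 1 = 2 then (1 : L) else 0)).Local v)›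
    ∀ (μT : Measure ↥(cmBorelTriple L 2 v).M) [μT.IsHaarMeasure],
    Representation.smoothTrace (G := (UnitaryGroup.cmDatum L 2 (Matrix.of fun i j : Fin 2 => if i.val + j.val + 1 = 2 then (1 : L) else 0)).Local v) (UnitaryGroup.cmPrincipalSeries L 2 v χ) ν φ =
      (((μT.real {t : ↥(cmBorelTriple L 2 v).M |
          (t : ↥(unitaryGroupOfForm (conjLocal L (IsCMField.complexConj L) v) (cmLocalForm L 2 v))) ∈
            cmLocalIntegralLevel L 2 (Matrix.of fun i j : Fin 2 => if i.val + j.val + 1 = 2 then (1 : L) else 0) v})⁻¹ : ℝ) : ℂ) *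
        ∫ t, ((χ t : ℂˣ) : ℂ) * (vanDijkWeight₂ L v t *
          classOrbitalIntegral m φ (ConjClasses.mk ((t : ↥(unitaryGroupOfForm (conjLocal L (IsCMField.complexConj L) v) (cmLocalForm L 2 v))) : (UnitaryGroup.cmDatum L 2 (Matrix.of fun i j : Fin 2 => if i.val + j.val + 1 = 2 then (1 : L) else 0)).Local v))) ∂μT := by
  intro μT _
  obtain ⟨w⟩ := (inferInstance : Nonempty (PlacesOver L v))
  have hw : IsCMField.complexConj L • w.1 = w.1 := hns w
  -- the organ's measurable structure on `G₂`, re-read on the (definitionally equal) matrix carrier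
  letI hmsU : MeasurableSpace ↥(unitaryGroupOfForm (conjLocal L (IsCMField.complexConj L) v) (cmLocalForm L 2 v)) := ‹MeasurableSpace ((UnitaryGroup.cmDatum L 2 (Matrix.of fun i j : Fin 2 => if i.val + j.val + 1 = 2 then (1 : L) else 0)).Local v)›
  haveI : BorelSpace ↥(unitaryGroupOfForm (conjLocal L (IsCMField.complexConj L) v) (cmLocalForm L 2 v)) := ⟨BorelSpace.measurable_eq (α := (UnitaryGroup.cmDatum L 2 (Matrix.of fun i j : Fin 2 => if i.val + j.val + 1 = 2 then (1 : L) else 0)).Local v)⟩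
  haveI := locallyCompactSpace_cmBorelU L 2 v
  -- the identity frame
  have h1 : formCongr (conjLocal L (IsCMField.complexConj L) v) (1 : GL (Fin 2) (UnitaryGroup.LocalRing L v))
      ((Matrix.of fun i j : Fin 2 => if i.val + j.val + 1 = 2 then (1 : L) else 0).map (algebraMap L (UnitaryGroup.LocalRing L v))) =
      (1 : UnitaryGroup.LocalRing L v) • (Matrix.of fun i j : Fin 2 => if i.val + j.val + 1 = 2 then (1 : L) else 0).map (algebraMap L (UnitaryGroup.LocalRing L v)) := by
    rw [formCongr_one_eq, one_smul]
  have he : ∀ g, (cmDatumLocalCongr L v (1 : GL (Fin 2) (UnitaryGroup.LocalRing L v)) isUnit_one h1) g = g := fun g => by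
    apply Subtype.ext
    rw [coe_cmDatumLocalCongr_apply, inv_one, mul_one, one_mul]
  have hes : ∀ g, (cmDatumLocalCongr L v (1 : GL (Fin 2) (UnitaryGroup.LocalRing L v)) isUnit_one h1).symm g = g := fun g => by
    conv_lhs => rw [← he g]
    exact (cmDatumLocalCongr L v (1 : GL (Fin 2) (UnitaryGroup.LocalRing L v)) isUnit_one h1).symm_apply_apply g
  have hecoe : (fun x : ↥(unitaryGroupOfForm (conjLocal L (IsCMField.complexConj L) v) (cmLocalForm L 2 v)) =>
      φ ((cmDatumLocalCongr L v (1 : GL (Fin 2) (UnitaryGroup.LocalRing L v)) isUnit_one h1) x)) = φ := funext fun x => by rw [he]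
  have hmap : (Measure.map (⇑(cmDatumLocalCongr L v (1 : GL (Fin 2) (UnitaryGroup.LocalRing L v)) isUnit_one h1).symm) ν :
      Measure ↥(unitaryGroupOfForm (conjLocal L (IsCMField.complexConj L) v) (cmLocalForm L 2 v))) = ν := by
    have : (⇑(cmDatumLocalCongr L v (1 : GL (Fin 2) (UnitaryGroup.LocalRing L v)) isUnit_one h1).symm :
        (UnitaryGroup.cmDatum L 2 (Matrix.of fun i j : Fin 2 => if i.val + j.val + 1 = 2 then (1 : L) else 0)).Local v →
          ↥(unitaryGroupOfForm (conjLocal L (IsCMField.complexConj L) v) (cmLocalForm L 2 v))) = id := funext hes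
    rw [this]
    exact Measure.map_id
  -- the a.e. identification of `Φ := χ · vanDijkWeight₂ · O^{can}` with the (δ₂) integrand
  have hae : ∀ᵐ (t : ↥(cmBorelTriple L 2 v).M) ∂μT, ∀ (d : Fin 2 → (UnitaryGroup.LocalRing L v)ˣ)
      (hd : glDiagonal 2 (UnitaryGroup.LocalRing L v) d =
        ((t : ↥(unitaryGroupOfForm (conjLocal L (IsCMField.complexConj L) v) (cmLocalForm L 2 v))) : GL (Fin 2) (UnitaryGroup.LocalRing L v)))
      (hb : IsUnit ((((d 0)⁻¹ * d 1 : (UnitaryGroup.LocalRing L v)ˣ) : UnitaryGroup.LocalRing L v) - 1)),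
      ((χ t : ℂˣ) : ℂ) * (vanDijkWeight₂ L v t *
          classOrbitalIntegral m φ (ConjClasses.mk (t : ↥(unitaryGroupOfForm (conjLocal L (IsCMField.complexConj L) v) (cmLocalForm L 2 v))))) =
        ((χ t : ℂˣ) : ℂ) *
          ((rootDeltaChar (cmBorelTriple L 2 v).P
            ⟨(t : ↥(unitaryGroupOfForm (conjLocal L (IsCMField.complexConj L) v) (cmLocalForm L 2 v))), (cmBorelTriple L 2 v).M_le t.2⟩ : ℂˣ) : ℂ) *
        (((letI : MeasurableSpace (UnitaryGroup.LocalRing L v) := borel _; haveI : BorelSpace (UnitaryGroup.LocalRing L v) := ⟨rfl⟩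
          haveI : SecondCountableTopology (UnitaryGroup.LocalRing L v) := secondCountableTopology_localRing (E := L) v
          ((HeisRing.skewModulus (conjLocal L (IsCMField.complexConj L) v) (continuous_conjLocal L (IsCMField.complexConj L) v) hb.unit
              (LineRing.map_unit_torusScalar_sub_one_two (conjLocal L (IsCMField.complexConj L) v) (cmLocalForm_eq_over L 2 v) t hd hb))⁻¹ :
                NNReal)) : ℝ) : ℂ)⁻¹ *
        classOrbitalIntegral m φ
          (ConjClasses.mk ((cmDatumLocalCongr L v (1 : GL (Fin 2) (UnitaryGroup.LocalRing L v)) isUnit_one h1)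
            (t : ↥(unitaryGroupOfForm (conjLocal L (IsCMField.complexConj L) v) (cmLocalForm L 2 v))))) := by
    filter_upwards with t
    intro d hd hb
    -- `d` IS the pair of torus entries of `t`
    obtain rfl : d = fun i => torusEntry (conjLocal L (IsCMField.complexConj L) v) (cmLocalForm L 2 v) i t :=
      funext fun i => (torusEntry_eq_of_glDiagonal_eq _ _ i t d hd).symm
    rw [he, vanDijkWeight₂, dif_pos hb]
    ring
  -- (δ₂): van Dijk against canonical orbital integrals
  have key := smoothTrace_cmPrincipalSeries_two_map_symm_eq_inv_mul_integral L
    (Matrix.of fun i j : Fin 2 => if i.val + j.val + 1 = 2 then (1 : L) else 0) (antidiagOne_isHermitian L 2) (isUnit_antidiagOne_det L 2) w hw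
    (1 : GL (Fin 2) (UnitaryGroup.LocalRing L v)) isUnit_one h1 ν hcan χ hχ μT φ hφ hφc _ hae
  rw [hmap, hecoe] at key
  exact key

end Summit.HodgeConjecture.HodgeConjecture.Cruxes.H413.K2E3QuasiSplitTwoVanDijk

end
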